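import Mathlib
import HarnessLib
import Literature.MathematicalPhysics.QuantumLattice.DWaveSource
import Literature.MathematicalPhysics.QuantumLattice.HubbardScaleReportCT
import Literature.MathematicalPhysics.QuantumLattice.SymmetricRegimeCertificateT

/-!
# Route `AposterioriCapRg` — the glue into the target (item `stmt-HubbardSuperconductivity-14250`)

The support item `FixedPointOfCertifiedChain` of route `HubbardSuperconductivity/AposterioriCapRg`
is the curried implication

> `CapRgSymmetricCertificatePinned → SeededBrokenRegimeBoseFermiPinned →
>  AposterioriOrderCriterionR → FixedPointDWaveOrder`,

pure logic over the route's three certified-chain cruxes (same content as step 1 of the route's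
deciding theorem `closes`). The chain: `R = AposterioriOrderCriterionR` supplies its named
thresholds `(kStar, etaStar)`; crux [3] `SeededBrokenRegimeBoseFermiPinned` at those thresholds
supplies the accuracy `Θ = (c₀, w)`; crux [2] `CapRgSymmetricCertificatePinned` supplies the point
`(U, δ, μ)`, the density clause and, at `Θ`, the certificate `(K, Λ*, L₀)` of
`symmetricRegimeCertificateT` at the ONE literal record `capRgCornerDataT` shared by producer and
consumer; [3] returns `h₀ > 0` and `D : HubbardScaleData` with `D.MeetsThresholds kStar etaStar`,
`0 < D.meanFieldDensity.fst` and the certified enclosure of `hubbardScaleReportCT U μ D h` for every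
`h ∈ (0, h₀]`; `R` returns `m₀/2 ≤ dWaveOrderParameter U μ`, hence `HasDWaveOrder U μ` by
`hasDWaveOrder_iff` (`Iff.rfl`) since `m₀ > 0`. Producer-∀ / consumer-∃ on the accuracy, one literal
record on both sides.

DESIGN (summit precedent: `Theorems/AposterioriCapRgAssembly.lean`,
`Theorems/ThermalWedgeAssemblyStructural.lean`): this module does NOT import the route module
`Summits.HubbardSuperconductivity.HubbardSuperconductivity.Theses.AposterioriCapRg`. When the item
closes, the gate re-renders the route file with `import <this module>` and
`theorem FixedPointOfCertifiedChain_holds : FixedPointOfCertifiedChain := _root_.<this theorem>`;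
a closing module that itself imports the route module would close an import cycle. So the TYPE
below is spelled out STRUCTURALLY — the verbatim bodies of the route decls
`CapRgSymmetricCertificatePinned` (stmt-HubbardSuperconductivity-14045),
`SeededBrokenRegimeBoseFermiPinned` (stmt-HubbardSuperconductivity-14047),
`AposterioriOrderCriterionR` (stmt-HubbardSuperconductivity-13884) and `FixedPointDWaveOrder`
(stmt-HubbardSuperconductivity-1313) of Theses/AposterioriCapRg.lean (route rev 31) — so that it
is definitionally (by `δ`-unfolding of the five defs only) the route decl
`Summit.HubbardSuperconductivity.HubbardSuperconductivity.Theses.AposterioriCapRg.FixedPointOfCertifiedChain`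
(checked in a scratch file importing the Theses module:
`example : AposterioriCapRg.FixedPointOfCertifiedChain := aposterioriCapRg_fixedPointOfCertifiedChain_proof`,
rc 0), and the route file can import this module without a cycle. Imports:
`Literature.MathematicalPhysics.QuantumLattice.DWaveSource` (`HasDWaveOrder`,
`dWaveOrderParameter`, `hasDWaveOrder_iff`), `…HubbardScaleReportCT` (`HubbardScaleData`,
`hubbardScaleReportCT`), `…SymmetricRegimeCertificateT` (`SymmetricTolerance`, `TrigPolyC4v`,
`symmetricRegimeCertificateT`, `capRgCornerDataT`), Mathlib, HarnessLib. No analysis, no new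
definitions. Sources: KomaTasaki1994 §1 (order parameter; `hasDWaveOrder_iff`).
-/

namespace Summit.HubbardSuperconductivity.HubbardSuperconductivity.Theorems

/-- **Glue into the target of route `AposterioriCapRg`** (item `stmt-HubbardSuperconductivity-14250`,
`FixedPointOfCertifiedChain`), stated structurally: (finite CAP step with pinned interface
`CapRgSymmetricCertificatePinned`) → (h-uniform Bose–Fermi theorem
`SeededBrokenRegimeBoseFermiPinned`) → (a-posteriori order criterion `AposterioriOrderCriterionR`)
→ (fixed-point `d`-wave order `FixedPointDWaveOrder`), all four written out verbatim so that this
type unfolds to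
`Summit.HubbardSuperconductivity.HubbardSuperconductivity.Theses.AposterioriCapRg.FixedPointOfCertifiedChain`
by `δ`-reduction alone. Proof (pure logic): take `(kStar, etaStar)` from `R`; the accuracy `Θ`
from [3] at those thresholds; `(U, δ, μ)`, the density clause and the certificate `(K, Λ, L₀)` at
`Θ` from [2]; `h₀, D` with the thresholds met, `0 < m₀` and the certified enclosures from [3]; `R`
gives `m₀/2 ≤ dWaveOrderParameter U μ`, so `0 < dWaveOrderParameter U μ`, i.e. `HasDWaveOrder U μ`
(`hasDWaveOrder_iff`). [cite: KomaTasaki1994, §1] -/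
theorem aposterioriCapRg_fixedPointOfCertifiedChain_proof :
    (∃ U ∈ Set.Icc (2:ℝ) 3, ∃ δ ∈ Set.Icc (1/5:ℝ) (7/20), ∃ μ : ℝ, Filter.Tendsto (fun L : ℕ => ((Literature.MathematicalPhysics.QuantumLattice.hubbardTorusWith 2 (L + 1) 1 U μ).groundStateFunctional Literature.MathematicalPhysics.QuantumLattice.totalNumber).re / ((L + 1 : ℕ) : ℝ) ^ 2) Filter.atTop (nhds (1 - δ)) ∧ ∀ Θ : Literature.MathematicalPhysics.QuantumLattice.SymmetricTolerance, ∃ (K : Literature.MathematicalPhysics.QuantumLattice.TrigPolyC4v) (Λ : ℝ) (L₀ : ℕ), Literature.MathematicalPhysics.QuantumLattice.symmetricRegimeCertificateT U μ Literature.MathematicalPhysics.QuantumLattice.capRgCornerDataT Θ K Λ L₀) →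
      (∀ kStar etaStar : ℚ, 0 < kStar → 0 < etaStar → ∃ Θ : Literature.MathematicalPhysics.QuantumLattice.SymmetricTolerance, ∀ U ∈ Set.Icc (2:ℝ) 3, ∀ δ ∈ Set.Icc (1/5:ℝ) (7/20), ∀ μ : ℝ, Filter.Tendsto (fun L : ℕ => ((Literature.MathematicalPhysics.QuantumLattice.hubbardTorusWith 2 (L + 1) 1 U μ).groundStateFunctional Literature.MathematicalPhysics.QuantumLattice.totalNumber).re / ((L + 1 : ℕ) : ℝ) ^ 2) Filter.atTop (nhds (1 - δ)) → ∀ (K : Literature.MathematicalPhysics.QuantumLattice.TrigPolyC4v) (Λ : ℝ) (L₀ : ℕ), Literature.MathematicalPhysics.QuantumLattice.symmetricRegimeCertificateT U μ Literature.MathematicalPhysics.QuantumLattice.capRgCornerDataT Θ K Λ L₀ → ∃ h₀ : ℝ, 0 < h₀ ∧ ∃ D : Literature.MathematicalPhysics.QuantumLattice.HubbardScaleData, D.MeetsThresholds kStar etaStar ∧ 0 < D.numPatches ∧ 0 < D.meanFieldDensity.fst ∧ ∀ h ∈ Set.Ioc (0:ℝ) h₀, ∃ L₀' : ℕ, D.IsCertifiedEnclosure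 (Literature.MathematicalPhysics.QuantumLattice.hubbardScaleReportCT U μ D h) L₀') →
        (∃ kStar etaStar : ℚ, 0 < kStar ∧ 0 < etaStar ∧ ∀ (U μ h₀ : ℝ) (D : Literature.MathematicalPhysics.QuantumLattice.HubbardScaleData), 0 < h₀ → (∀ h ∈ Set.Ioc (0:ℝ) h₀, ∃ L₀ : ℕ, D.IsCertifiedEnclosure (Literature.MathematicalPhysics.QuantumLattice.hubbardScaleReportCT U μ D h) L₀) → D.MeetsThresholds kStar etaStar → ((D.meanFieldDensity.fst : ℚ) : ℝ) / 2 ≤ Literature.MathematicalPhysics.QuantumLattice.dWaveOrderParameter U μ) →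
          (∃ U ∈ Set.Icc (2:ℝ) 3, ∃ δ ∈ Set.Icc (1/5:ℝ) (7/20), ∃ μ : ℝ, Filter.Tendsto (fun L : ℕ => ((Literature.MathematicalPhysics.QuantumLattice.hubbardTorusWith 2 (L + 1) 1 U μ).groundStateFunctional Literature.MathematicalPhysics.QuantumLattice.totalNumber).re / ((L + 1 : ℕ) : ℝ) ^ 2) Filter.atTop (nhds (1 - δ)) ∧ Literature.MathematicalPhysics.QuantumLattice.HasDWaveOrder U μ) := by
  intro h2 h3 hR
  obtain ⟨kStar, etaStar, hk, he, hRall⟩ := hR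
  obtain ⟨Θ, h3all⟩ := h3 kStar etaStar hk he
  obtain ⟨U, hU, δ, hδ, μ, hdens, hcert⟩ := h2
  obtain ⟨K, Λ, L₀, hc⟩ := hcert Θ
  obtain ⟨h₀, hh₀, D, hmeets, _hnp, hm₀, hencl⟩ := h3all U hU δ hδ μ hdens K Λ L₀ hc
  have hle := hRall U μ h₀ D hh₀ hencl hmeets
  have hm₀' : (0 : ℝ) < ((D.meanFieldDensity.fst : ℚ) : ℝ) := by exact_mod_cast hm₀
  refine ⟨U, hU, δ, hδ, μ, hdens, ?_⟩
  rw [Literature.MathematicalPhysics.QuantumLattice.hasDWaveOrder_iff]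
  linarith

end Summit.HubbardSuperconductivity.HubbardSuperconductivity.Theorems
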